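import Summits.ResolutionOfSingularities.ResolutionOfSingularities.Theorems.HugValuationCutChains
import HarnessLib
import Summits.ResolutionOfSingularities.Statement
import Literature.AlgebraicGeometry.Resolution.QuadraticTransforms
import Literature.AlgebraicGeometry.Resolution.BlowupSequencesExtensions
import Summits.ResolutionOfSingularities.ResolutionOfSingularities.Theorems.ForcedTowerClasses
import Summits.ResolutionOfSingularities.ResolutionOfSingularities.Theorems.DivergentTowerClasses
import Summits.ResolutionOfSingularities.ResolutionOfSingularities.Theorems.MonomialTowerClasses
import Summits.ResolutionOfSingularities.ResolutionOfSingularities.Theorems.HugDimensionClasses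
import Summits.ResolutionOfSingularities.ResolutionOfSingularities.Theorems.HugDimensionKernels
import Summits.ResolutionOfSingularities.ResolutionOfSingularities.Theorems.SurfaceShadowClasses
import Summits.ResolutionOfSingularities.ResolutionOfSingularities.Theorems.SurfaceShadowKernels
import Summits.ResolutionOfSingularities.ResolutionOfSingularities.Theorems.ContactShadowClasses
import Summits.ResolutionOfSingularities.ResolutionOfSingularities.Theorems.NearPointCutClasses

/-!
# HugValuationCut — decomp-res lens-4 («minimal counterexample / extremal reduction»), generation 14

[WRITER NOTE (decomp-res writer g5): tree file 2/4 = the node record (this lens header, VERBATIM) + §2 the port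
DATUM `HugShadow`
+ §3 tower classes and pieces + §4 ports + the all-markings classes of §6, statement-only; §1 = `HugValuationCutChains`, the
PROVED lemmas of §3 and §5 (incl. the located-residual structure of a dense shadow) = `HugValuationCutKernels`,
§6 up-links to
32260 / 31570 / 30253 BY NAME = `MaxContactCutHugValuationCut`.  Option lines and `import Mathlib` dropped (critic row 91).]
Target (tree ASIDE item 32260, the g11/g13 located residual), BY NAME:
`MaxContactCut.NoSingularSurfaceHuggingTowers = ∀ n ≥ 1, SingularSurfaceHuggingTowersTerminate n`, the class of
infinite forced towers (isolated closed points of maximal order blown up for ever over a regular base of dimension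
`≤ 4` of characteristic `p`) that are never monomial, hug NO curve germ, hug SOME surface germ, and hug NO REGULAR
surface germ.  Up-links BY NAME to 32203 / 31570 / 30253 (§6).

## Thesis (the extremal parameter of this generation: the VALUE GROUP of the hug)

g10 minimised the DIMENSION of a hugged germ, g11 its REGULARITY, g13 the near-point Hilbert–Samuel stratum.  g14
minimises the one invariant of an eternally hugged surface that none of the cell's nodes has typed: the valuations of
the function field `K = K(Σ)` of the hugged surface `Σ` whose valuation rings DOMINATE the whole chain of local rings
`R_0 ⊂ R_1 ⊂ ⋯ ⊂ K`, `R_i = 𝒪_{Σ_i, x_i}` (`Σ_i` = i-th strict transform of `Σ`, `x_i` = the marked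
point).  The chain is
a sequence of QUADRATIC TRANSFORMS of two-dimensional local domains (tree `IsQuadraticTransform`), so (§1, all PROVED
in Lean over an abstract `HugChain K`):
* (V1, Chevalley) a dominating valuation ring `V` exists (`HugChain.exists_dominatedBy`);
* (V3, coarsening dichotomy) if `V` dominates and a coarsening `V ≤ V' ≠ K` does not, the centres `𝔪_{V'} ∩ R_i` are a
  compatible chain of non-zero, eventually non-maximal primes (`hasHeightOneChain_of_coarsening`) — a HUGGED CURVE, excluded
  in the class; so domination is inherited by coarsenings (`dominatedBy_of_le`) and no proper coarsening `≠ K` is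
  `ℤ`-valued (`not_isZValued_of_lt`);
* (V4, value descent) a dominating `V` whose non-zero nonunits of the `R_i` have values bounded below by `ε > 0` under a
  real valuation cutting out `V` is the UNION `⋃ R_i` (`mem_iUnion_of_gap`); in particular every `ℤ`-valued dominating
  ring is `⋃ R_i` (`mem_iUnion_of_isZValued`) — the marked points are then the centres of ONE ARC `Spec V → Σ`;
* (V5, creep) if the real valuation cutting out a dominating `V` has dense values, the minimal values of the maximal
  ideals `𝔪_i` creep to `0` (`creep`).
With Abhyankar's inequality this yields the remark (R) below: in the class `¬ CurveHugging` EVERY dominating valuation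
ring has RANK ONE, and the towers with a shadow split EXACTLY (excluded middle, kernel `singularSurface_iff_pieces`) into
  (D) DISCRETE — some shadow is dominated by a `ℤ`-valued ring (an arc), bisected by perfectness of the ground field into
      (D-perf) and (D-imp) (kernel `noTower_iff_perfect_and_imperfect`, using the tree's `NoTowerPerfect`), and
  (Z) DENSE — no shadow is: every dominating ring is rank-one NON-DISCRETE (value group a dense subgroup of `ℝ`:
      rational rank two, or rational rank one not finitely generated) with creeping values.

## Pieces (tags in the critic's vocabulary) — `Target ⟸ (D-perf) ∧ (D-imp) ∧ (Z)` given the port, EXACT given the port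

* `ShadowPort n` — COSTUME (port DATUM `HugShadow T`, pinned by stalk isomorphisms `R i ≃+*
𝒪_{St(m+i),pt(m+i)} ⧸ 𝓘(Σ_i)`;
  paper proof (P1)); counted 0.
* `DiscretePerfectShadowTowersTerminate n` (D-perf) — DECIDED-MOD-PORT: `discretePerfect_of_law` from the ENGINE
  `DiscreteShadowLaw n` (paper proof (P3), complete below; a NEW LEMMA in this generality whose characteristic-zero /
  hypersurface antecedent is the Nash-multiplicity / arc-lifting lemma) and the dictionary clause `HugShadow.regular`.
* `DiscreteImperfectShadowTowersTerminate n` (D-imp) — UNDECIDED residual (regular-versus-smooth over an imperfect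
  ground field: the three uses of perfectness in (P3) are listed in (P3′) with the example that separates them); tag
  IDEA-NEEDED; strictly inside the barrier `Literature.Barriers.ResolutionOfSingularities.SmoothVsRegularImperfectBase`'s
  territory, which is WHY it is cut off from (D-perf) rather than merged.
* `DenseShadowTowersTerminate n` (Z) — THE LOCATED RESIDUAL, UNDECIDED, INSTRUMENTABLE; normal form PROVED in Lean
  as far as the abstract layer reaches (Z1 `HugShadow.exists_dominatedBy`, Z2/Z2′ `dominatedBy_of_le` /
  `not_isZValued_of_lt`, Z3 `creep`), RANK ONE by (R).
Port-free necessity `pieces_of_singularSurface`; exactness `singularSurface_iff_pieces`; perfect-field corollary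
`singularSurfacePerfect_of_g14 : ShadowPort n → DiscreteShadowLaw n → (Z) → NoTowerPerfect n SingularClass` — over a
perfect ground field THE WHOLE SINGULAR-SURFACE LEAF IS THE DENSE COLUMN.

WHY EACH PIECE IS STRICTLY WEAKER THAN THE TARGET (and not a costume of it): each is the target restricted to a
sub-class cut out by a property of a DIFFERENT OBJECT (the value group of the dominating valuations of the shadow
chain, resp. the ground field), the three sub-classes are pairwise disjoint on towers with a shadow, and one of them
is DECIDED — so neither residual is equivalent to the target unless the decided column is empty for a trivial reason,
which (P3) shows it is not: discrete arcs through singular points exist in every singular class (every surface germ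
has arcs through its singular point; what (P3) proves is that the tower LEAVES the singular locus along them, i.e. the
class (D-perf) is empty BECAUSE OF A THEOREM, the way g10's monomial column and g11's regular-surface column are).
The residual (Z) is not closed under «prepend a blow-up at a regular point» arguments of the summit-equivalence type:
membership is a property of the tail of the chain in `K(Σ)`, insensitive to finitely many initial stages, exactly like
the target class itself — (Z) is a genuine SUB-class (the discrete towers are removed), not a re-indexing.

## (P1) Paper proof of the port `ShadowPort` (COSTUME; routine scheme theory over the tree's definitions)

Let `T` be in the class, `H` on `St m` hugged (`HugsGerm T m H`) with `dim 𝒪_{St m,pt m}/H = 2`, and no curve hugged.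
(a) ETERNAL COMPONENT.  The tree's `strictTransformIdeal` is the saturation `⨆ₙ (H𝒪 : 𝓘_Eⁿ)`, whose zero set is the
closure of `π⁻¹(V(H) ∖ {centre})`; hence set-theoretically `V(strictIter j H) = ⋃_Σ Σ_j` over the
irreducible components
`Σ` of `V(H)` (`Σ_j` = iterated strict transform of `Σ`, irreducible or empty), and «off once, off for ever»
(`x_j ∉ Σ_j ⟹ x_{j+1} ∉ π⁻¹(Σ_j) ⊇ Σ_{j+1}`).  The sets `I_j = {Σ ∋-component : x_j ∈ Σ_j}` are
finite, non-empty
(`x_j ∈ V(strictIter j H)`) and decreasing, so some component `Σ` through `pt m` survives for ever.  `dim_{pt m} Σ ≤ 2`;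
`= 0` is impossible (a point does not survive one blow-up), `= 1` would be a hugged curve (its reduced ideal sheaf `H'`
has `HugsGerm T m H'`, `dim = 1`, i.e. `CurveHugging T`) — so `Σ` is an INTEGRAL SURFACE germ, hugged; replace `H` by
the ideal sheaf of `Σ` (still `idealOrder ≠ ⊤`: `dim 𝒪_{St m, pt m} ≥ 3`, forced by `dim 𝒪/H = 2` and
`H_{pt m} ≠ 0`).
(b) CHAIN.  `Σ_{j+1} → Σ_j` is the blow-up of the integral surface `Σ_j` at the closed point `x_j` (strict transform =
blow-up of the restricted centre, Hartshorne II.7.15), so `R_{j+1} = 𝒪_{Σ_{j+1},x_{j+1}}` is a localisation of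
`R_j[𝔪_j/z]` at a prime over `𝔪_j`, i.e. `IsQuadraticTransform R_j R_{j+1}` inside `K = Frac R_0 = K(Σ)` [Cutkosky,
Resolution of Singularities §2.1; Abhyankar 1956 §1; kiyek–Vicente VIII §3–4,
[corpus:book:kiyeknd-resolution-curve-surface-
singularities p.518–526]; the tree proves the ambient analogue `IsBlowup.isQuadraticTransformAlong_range_stalkEmb`];
`stalkIso` is the identification `R_j ≅ stalk ⧸ stalkIdeal (strictIter j)` (the strict transform of an integral subscheme
is the scheme-theoretic closure of its isomorphic image, integral).  `dim R_j = 2` for all `j` (dimension formula,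
`κ(x_{j+1})/κ(x_j)` finite).
(c) `regular`: if `R_i` is regular, the ideal sheaf `strictIter i H` on `St (m+i)` is hugged from stage `m+i` on (its
iterated strict transforms are those of `H`, re-indexed) with regular two-dimensional local ring: `RegularSurfaceHugging T`.
(d) `curve` = (P2).

## (P2) Paper proof of the dictionary clause `curve` (`HasHeightOneChain → CurveHugging`)

Given `Q ⊆ K` as in `HasHeightOneChain`: `𝔮_i := Q ∩ R_i` is a prime ideal of `R_i` (additive, absorbing, prime,
`1 ∉ Q`), non-zero (`a ∈ 𝔮_i`), and for `i ≥ i₀` not maximal (`x ∈ 𝔪_i ∖ 𝔮_i`: `x` stays a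
nonunit up the chain by
domination, `HugChain.inv_mem_of_inv_mem`).  In the two-dimensional local domain `R_i` it has height one: `Γ_i := V(𝔮_i)`
is an integral curve germ on `Σ_i` through `x_i`, and `𝔮_{i+1} ∩ R_i = 𝔮_i` says `Γ_{i+1}` dominates `Γ_i` and is not
inside the exceptional curve (else `𝔮_{i+1} ∩ R_i = 𝔪_i`), so `Γ_{i+1}` IS the strict transform of `Γ_i`.  The reduced
ideal sheaf of the closure of `Γ_{i₀}` in `St (m+i₀)` is then hugged from stage `m+i₀` on with one-dimensional local
ring: `CurveHugging T` (= `HugsGermOfDim T 1`, any stage allowed).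

## (P3) Paper proof of the engine `DiscreteShadowLaw` (perfect ground field `k`) — COMPLETE

Data: `S : HugShadow T`, `V` a `ℤ`-valued valuation ring of `K = S.K` dominating the chain (so `V ≠ K`, as `R_0` is not a
field), `ν : K× → ℤ` its valuation.  By (V4) `V = ⋃ R_i`.  Write `A_i := 𝒪_{St(m+i), x_i}` (regular local, dimension
`d ∈ {3,4}` for all `i`, essentially of finite type over `k`), `𝔭_i := ker (A_i → R_i)` (prime of height `r := d − 2`),
`η` = the generic point of `Σ` (the same for all `i`; `A_{i,𝔭_i} = 𝒪_{St,η}` regular of dimension `r`).  Since `k` is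
PERFECT: (i) `A_i` is smooth over `k`, `Ω_{A_i/k}` is free of rank `d`, and for every regular system of parameters
`u_1,…,u_d` of `A_i` the `du_l` are a basis (because `κ(x_i)/k` is finite separable, `𝔪_i/𝔪_i² ≅
Ω_{A_i/k} ⊗ κ(x_i)`);
(ii) the same isomorphism `𝔪_y/𝔪_y² ≅ Ω ⊗ κ(y)` holds at every point `y` (all residue fields are
separably generated).
STEP 0 (hull and invariant).  Choose `F_1,…,F_r ∈ 𝔭_0` generating `𝔭_0 A_{0,𝔭_0}` (a regular s.o.p. of
`𝒪_{St,η}` with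
denominators cleared).  For a system `F = (F_1..F_r) ⊆ 𝔭_i` generating `𝔭_i A_{𝔭_i}` put
  `J(F) := I_r(Jac F)` = the ideal of `r × r` minors of the matrix of `(dF_j)_j` in any basis of `Ω_{A_i/k}` (basis-free),
  `c(F) := ν(J(F) R_i) = min {ν(ḡ) : g ∈ J(F)} ∈ ℕ ∪ {∞}` (bars = images in `R_i ⊆ V`).
`c(F) < ∞`: at `η`, `V(F)` has local ring `A_𝔭/(F) = κ(η)`, regular of dimension `dim A_𝔭 − r`, so by
(ii) the `F_j` are
independent in `𝔪_η/𝔪_η²`, i.e. some minor is a unit at `η`, i.e. `J(F) ⊄ 𝔭_i`, so `J(F)R_i ≠ 0`.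
STEP 1 (dichotomy at stage i).  `c(F) = 0` iff some minor is a unit of `A_i` (a local surjection `A_i → R_i` and
domination `𝔪_V ∩ R_i = 𝔪_{R_i}`), iff the `dF_j(x_i)` are linearly independent in `Ω ⊗ κ(x_i)`; then
the images of the
`F_j` in `𝔪_i/𝔪_i²` are independent (no separability needed in this direction), `A_i/(F)` is a regular local ring of
dimension 2, a domain containing the two-dimensional domain quotient `R_i = A_i/𝔭_i` (`(F) ⊆ 𝔭_i`), hence equal to it:
`R_i` IS REGULAR — done.  Otherwise `c(F) ≥ 1` and, by (i), the images `f_j ∈ 𝔪_i/𝔪_i²` are linearly DEPENDENT over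
`κ(x_i)`: `Σ ā_j f_j = 0`, say `ā_1 ≠ 0`; lift to `a_j ∈ A_i` (`a_1` a unit) and replace `F_1` by `F̃_1 := Σ a_j F_j ∈ 𝔪_i²`
(row operation by `G ∈ GL_r(A_i)`): same ideal, still in `𝔭_i`, and `Jac F̃ ≡ G · Jac F (mod 𝔭_i)` (the
terms `F_j da_j`
die in `R_i`), so `J(F̃)R_i = J(F)R_i` and `c` is unchanged.  So w.l.o.g. `ν_1 := ord_{𝔪_i} F_1 ≥ 2` (all `ν_j ≥ 1`).
STEP 2 (one blow-up).  Let `ρ_i := min ν(𝔪_i R_i) ≥ 1` (an integer!) and pick `u_1 ∈ 𝔪_i` with `ν(ū_1) = ρ_i`; elements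
of `𝔪_i²` have value `≥ 2ρ_i`, so `u_1 ∉ 𝔪_i²`; complete to a regular s.o.p. `u_1,…,u_d`.  The point
`x_{i+1}` lies in
the chart `u_1 ≠ 0` of the blow-up (the generator `u_l` of `𝔪_i A_{i+1}` has `ν(ū_l) = ρ_i`, so `u_1/u_l` has value `0`,
is a unit of `R_{i+1}` by domination, hence of `A_{i+1}`): `A_{i+1} = B_𝔫`, `B = A_i[u'_2,…,u'_d]`, `u'_l = u_l/u_1`, and
`du_1, du'_2, …, du'_d` is a basis of `Ω_{A_{i+1}/k}` (they generate a free module of rank `d`).  Put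
`F'_j := F_j / u_1^{ν_j} ∈ B ∩ 𝔭_i A_𝔭 = 𝔭_{i+1}` — a system in `𝔭_{i+1}` generating `𝔭_{i+1}A_𝔭 = 𝔭_i A_𝔭`.  From
`dF_j = ν_j u_1^{ν_j−1} F'_j du_1 + u_1^{ν_j} dF'_j` and `du_l = u'_l du_1 + u_1 du'_l`:
  `Jac' = D · (Jac · T − Corr)`, `D = diag(u_1^{−ν_j})`, `T = [[1,0],[u', u_1·1_{d−1}]]`, `Corr` = the single column
  `(ν_j F_j/u_1)_j = (ν_j u_1^{ν_j−1} F'_j)_j` with entries in `𝔭_{i+1}`.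
Reduce modulo `𝔭_{i+1}` into `K` (through `A_{i+1}[u_1⁻¹]`, as `ū_1 ≠ 0`): `J̄ac' = D̄ · J̄ac · T̄`, and
`T̄⁻¹ = ū_1⁻¹ · S̄` with `S = [[u_1, 0],[−u', 1]]` having entries in `R_{i+1}`.  Hence
`J̄ac = D̄⁻¹ · J̄ac' · S̄ · ū_1⁻¹` and, taking `r × r` minors (all rows) over the ring `R_{i+1}`,
  `J(F) R_{i+1} ⊆ ū_1^{Σ_j ν_j − r} · J(F') R_{i+1}`, i.e. **`c(F') ≤ c(F) − (Σ_j (ν_j − 1)) · ρ_i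
≤ c(F) − 1`.**
STEP 3.  Iterate (row-reduce, blow up): the non-negative integers `c` strictly decrease while the dichotomy says
«singular», so after at most `c(F^{(0)})` stages STEP 1 ends in «`R_i` regular».  ∎
(So in fact all but at most `c₀` of the `R_i` are regular; `c₀` = order of contact of the arc with the Jacobian ideal of a
generic complete-intersection hull of `Σ`.)
(P3′) THE THREE USES OF PERFECTNESS: (i) smoothness of the regular `A_i` over `k` (free `Ω` with basis `du_l`) — fails for
regular non-smooth points over imperfect `k` (barrier `SmoothVsRegularImperfectBase`); (ii) injectivity of
`𝔪/𝔪² → Ω ⊗ κ` at `x_i` (row reduction in STEP 1) — fails when `κ(x_i)/k` is inseparable; (iii) the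
Jacobian criterion at
`η` (`c₀ < ∞`) — fails when `K(Σ)/k` is not separably generated.  Separating example (k = 𝔽_p(s), σ^p =
s): the integral
surface `z^p = s x^p` × 𝔸¹_y ⊂ 𝔸³_k has identically vanishing Jacobian (`c₀ = ∞`), its point blow-up
at the origin is
`V(z'^p − s) ≅ 𝔸²_{k(σ)}` — REGULAR, nowhere smooth — so along the arc `(x,y,z) = (t, y(t), σt)` (in
the normalisation)
the conclusion of the engine HOLDS at stage 1 while every step of its proof is void.  We know no example where the
conclusion fails; (D-imp) is filed UNDECIDED · IDEA-NEEDED (candidate idea: replace `Ω_{A/k}` by `Ω_{A/k₀}` for an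
admissible subfield `k₀ ⊆ k` with `[k : k₀ k^p]`-basis adapted to `x_i` — Cossart–Piltant's «differential bases over
non-perfect fields»; not attempted here).

## (R) Rank one (paper remark, two lines over the Lean lemmas)

Let `V` dominate the shadow chain, class `¬ CurveHugging`.  A proper coarsening `V ⊊ V' ≠ K` dominates (Z2) and is the
composite of `V` with a non-trivial valuation of `κ(V')` trivial on `k`, so `tr.deg_k κ(V') ≥ 1`; Abhyankar's inequality
`rank + tr.deg ≤ 2` for `K(Σ)/k` then forces `V'` divisorial, hence (Abhyankar's equality case) DISCRETE — contradicting
(Z2′) `not_isZValued_of_lt`.  So `rank V = 1`; and `V` itself is not divisorial (a `ℤ`-valued dominating ring is `⋃ R_i`,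
whose residue field `⋃ κ(x_i)` is algebraic over `k`).  NORMAL FORM OF THE RESIDUAL (Z): the marked points of a
singular-class tower over any field are the centres of a rank-one valuation of `K(Σ)` with residue field algebraic over
`k` and value group a DENSE subgroup of `ℝ`, whose values on the successive maximal ideals creep to `0` (Z3), and —
by the engine read contrapositively over perfect `k` — which is NOT approximable by arcs in the sense that no arc shares
all its centres.

## (Z0) First resident of (Z) — the census's zigzag, read valuatively (desk, exact)

The census's T-near-line (HOME/census/nearline/T-near-line-S.md, evidence → 32260) found, one stage below the quartic-cone
vertex over `𝔽₉`, the 2-CYCLE ZIGZAG on `Σ = {y² + x⁴·u(w) = 0}` (`u` a unit; «A₃ × line»): itinerary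
(axis point of the
double line, free point `[1:0:c]` with `c ≠ 0` of `ℙ(Dir)`, axis, `[1:0:c′]`, …), `e ≡ 2`, a near line at
every stage, no
line followed for ever (g13's first concrete (β2)-configuration).  If `u` is a square in `A` the germ is the union of the
two REGULAR germs `y = ± i x²√u`, both hugged: the tower is outside `SingularClass`.  Otherwise `𝔭 = (y² +
x⁴u)` is prime
and `R_i` is never normal (its normalisation `R_i[y/x²]` is regular with parameters `x, w`), so never regular; any
valuation `ν` dominating the chain dominates the quadratic sequence of the regular normalisation with the same centres,
and the free step onto `[1:0:c]` (`c` a unit) forces `ν(w/(x/w) − c) > 0`, i.e. `ν(x) = 2·ν(w)`, at the start of EVERY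
cycle, the roles of `(x, w)` passing to `(x/w, w/(x/w) − c)`.  Hence `ρ = (b, b, b/2, b/2, b/4, b/4, …)`: the value
group contains `b·ℤ[1/2]` — DENSE, rank one — and `Σρ_i = 4b < ∞` (geometric creep).  This is exactly the normal form
(Z1)–(Z3), and, as the engine (P3) demands over the perfect field `𝔽₉`, no ℤ-valued valuation dominates the zigzag.
JOINT RESIDUAL WITH g13 (both cuts EXACT on the same class, modulo their ports/engines): `NoNearLineTowers` ⟺
`NoDiscreteImperfectShadowTowers ∧ NoDenseShadowTowers` ⟺ 32260 — a counterexample tower has `e ≡ 2` with near lines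
infinitely often AND a dense (or imperfect-discrete) shadow with creeping values.

## Instrument asks (census) — (Z) is INSTRUMENTABLE

I-Z1 «value sequences of bed towers»: for the cell's recorded divergent candidates (T-moh / T-near-line beds), compute
the sequence `ρ_i = min ν(𝔪_i)` for the dominating valuation (equivalently the multiplicity sequence of the hugged surface
at the marked points and the Puiseux-type continued-fraction data of the point sequence: free/satellite pattern) and
classify: eventually periodic satellite pattern ⟺ rational rank 2 (quadratic-irrational slope) vs. unbounded free runs
⟺ rational rank 1 non-discrete; report `Σ ρ_i` and whether `inf ρ_i = 0` is reached polynomially or geometrically.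
I-Z2 «arc test»: for each bed, exhibit (or exclude up to a height bound) an arc sharing the first N centres; by (P3) an
arc sharing ALL centres certifies exit from the singular class in `≤ c₀` steps — a cheap falsifier of candidate towers.
Joint with g13's (β2) ask (near-point HS ledger): the HS function along a dense shadow is eventually constant (g13,
PROVED) — I-Z3: tabulate (HS stratum, ρ_i) jointly.

## Literature (search-before-claim; labels = source of the hit)

Quadratic transforms / domination / unions along valuations: Abhyankar, Ann. Math. 63 (1956) §1 Lemma 12 (regular
two-dimensional case of (V4)); Zariski–Samuel II, VI §17; kiyek–Vicente, Resolution of Curve and Surface Singularities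
VIII §3–§4 [corpus:book:kiyeknd-resolution-curve-surface-singularities p.518–526, p.538–559]; Cutkosky, Resolution of
Singularities §2.1; tree: `Literature.AlgebraicGeometry.Resolution.QuadraticTransforms` (defs used verbatim),
`DominatedUnions` (union-is-local pattern copied in V1), `LipmanValuativeQuadraticSequence` / `LipmanNoEternalNormalBranch`
(NORMALISED sequences — not applicable: our `Σ_i` are not normal, dead end below), `LocalUniformizationAbhyankarPlaces`
(Knaf–Kuhlmann; gives a regular ring BETWEEN the `R_i`, not one OF them — dead end below).  Arc lifting / Nash
multiplicity sequences (antecedents of (P3), characteristic 0, hypersurfaces or normal surfaces): Nash, Duke 81 (1995);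
Lejeune-Jalabert, Amer. J. Math. 112 (1990) 525–568; Gonzalez-Sprinberg & Lejeune-Jalabert, «Familles de courbes…»,
Thm 4-1, Prop. 4-3, Prop. 4-4 [corpus:book:editor1996-algebraic-geometry-singularities p.24–26] (`m_0+⋯+m_i−(i+1) =
min ord_t J(f)∘h̃`, hence `#{i : m_i > 1} ≤ ord_t J(f)∘h` — the `c`-descent of (P3) for hypersurfaces in char 0);
Hickel, Amer. J. Math. 115 (1993); Reguera, Compos. Math. 142 (2006) [graph: doi:10.1112/s0010437x05001582]; held and
read without a verbatim point-blow-up statement in char `p`: arXiv 0811.2421, 1404.0762, 0704.3327, math/0410145,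
math/0207171, 1011.2426, math/0609629; [galaxy:panama:236180251607088] (Arc Schemes volume, c419000–429000).  Queries
run (corpus fts + vec, galaxy --star all): "quadratic transform valuation dominates union", "arc lifting Nash blow-up
multiplicity sequence", "Nash multiplicity sequence|suite des multiplicités de Nash", "point blowing up along an arc
nonsingular", "valuation|quadratic sequence" in-book kiyek; no verbatim hit for (P3) in positive characteristic —
hence NEW LEMMA, own proof above.

## Barriers (catalogue `Literature/Barriers/ResolutionOfSingularities/`)

`SmoothVsRegularImperfectBase` — BITES exactly (D-imp) and is the reason for the perfect/imperfect bisection; (D-perf)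
and (Z) sit outside it.  `LocalMonomializationFails*` / `ResidualOrderUnbounded*` — not in the technique class (no
monomialisation, no residual order is used; the invariant `c` of (P3) is an order of contact along a FIXED valuation,
bounded by `c₀` by construction).  Technique class: valuation theory of two-dimensional function fields + Jacobian
arc-contact descent.

## Novelty (relative to the cell and the tree)

Lens-1 (`Theses/Valuative.lean`, 0641 ff.) uniformises along valuations of the AMBIENT fourfold; `AbhyankarShadows`
(Teissier semivaluation shadows) works on the ambient ideal; lens-3's proximity ledger (31770) and lens-6's satellite
cut read the point sequence in the ambient exceptional configuration; g13 (NearPointCut) reads the Hilbert–Samuel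
stratum.  None types the valuation ring of the HUGGED SURFACE'S OWN function field dominating the shadow chain, and
the item's docstring has the valuative picture in prose only.  New here: (1) the EXACT discrete/dense cut with
kernel-checked seams V1/V3/V4/V5 over the tree's `IsQuadraticTransform`; (2) the DECIDED discrete column over perfect
fields by the Jacobian-contact descent (P3); (3) the rank-one normal form of the residual with a creep law, which
makes (Z) instrumentable (I-Z1–I-Z3).

## Dead ends recorded this generation (one line each)

«Σρ_i = ∞ vs < ∞» as the cut — one-directional, `Σρ_i < ∞` is the norm for irrational valuations; sandwich «`R`
between quadratic transforms of a regular `S` ⟹ `R` regular» — false (`S[y²/x]`); Knaf–Kuhlmann LU for Abhyankar places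
— interleaved chains do not force a regular MEMBER; normalised reduction to Lipman 1978 — normalisations are not point
blow-ups; Fitting-ideal lattice `N_i ⊆ Ω_{K/k}` — does not stabilise even at smooth points (use minors of a hull
instead: (P3)); canonical `V^max` per tower — dominating rings are not unique, so the pieces quantify over ALL of them;
Mathlib `Valuation.RankOne`/`IsDiscreteValuationRing` API — replaced by the elementary `IsZValued` / real-cut hypotheses.
g13 dead end d7 (valuative engines along PRESCRIBED centres in char `p` are unprinted) is honoured: only the discrete
column over perfect fields is credited, with its own complete proof.
-/

noncomputable section

open CategoryTheory AlgebraicGeometry IsLocalRing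
open Literature.AlgebraicGeometry.Resolution
open Summit.ResolutionOfSingularities.ResolutionOfSingularities.Theorems
open WeakOrderReduction ForcedTowerClasses DivergentTowerClasses MonomialTowerClasses
open HugDimensionClasses HugDimensionKernels SurfaceShadowClasses SurfaceShadowKernels
open ContactShadowClasses (NoTowerImperfect)
open NearPointCut (SingularClass)

namespace Summit.ResolutionOfSingularities.ResolutionOfSingularities.Theorems.HugValuationCut

/-! ## §2 The shadow of a surface-hugging tower (port DATUM, pinned by stalk isomorphisms) -/

/-- **HUG SHADOW** of a forced tower `T`: an INTEGRAL surface germ `Σ = V(germ) ∋ pt m` hugged for ever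
(`HugsGerm`, local ring of Krull dimension two), together with its SHADOW CHAIN — the local rings
`R i = 𝒪_{Σ_i, pt (m+i)}` of the iterated strict transforms `Σ_i = V(strictIter T m germ i)` read in ONE field `K`
(the function field of `Σ`) as a hug chain (each step a quadratic transform, `Frac (R 0) = K`), PINNED to the tower by
ring isomorphisms with the stalk quotients, and the two DICTIONARY clauses the kernels consume: a compatible chain of
height-one primes of the `R i` is a hugged CURVE, and a regular member re-indexes the hug to a REGULAR surface hug.
Delivered by the COSTUME port `ShadowPort` (paper proof (P1) in the module docstring). -/
structure HugShadow (T : ForcedTower) : Type 1 where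
  /-- the hugging stage -/
  m : ℕ
  /-- the hugged integral surface germ `V(germ) ∋ pt m` -/
  germ : (T.St m).IdealSheafData
  /-- it is hugged for ever -/
  hugs : HugsGerm T m germ
  /-- its local ring has Krull dimension two -/
  dim_two : ringKrullDim ((T.St m).presheaf.stalk (T.pt m) ⧸ stalkIdeal germ (T.pt m)) = (2 : WithBot ℕ∞)
  /-- the function field of the germ -/
  K : Type
  [instField : Field K]
  /-- the shadow chain `R i = 𝒪_{Σ_i, pt (m+i)} ⊆ K` -/
  C : HugChain K
  /-- PIN: `R i ≅ 𝒪_{St (m+i), pt (m+i)} / (i-th strict transform of the germ)` -/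
  stalkIso : ∀ i, Nonempty (C.R i ≃+*
    ((T.St (m + i)).presheaf.stalk (T.pt (m + i)) ⧸ stalkIdeal (strictIter T m germ i) (T.pt (m + i))))
  /-- DICTIONARY (curves): a compatible chain of non-zero, eventually non-maximal primes is a hugged curve germ -/
  curve : C.HasHeightOneChain → CurveHugging T
  /-- DICTIONARY (regularity): a regular member of the chain re-indexes the hug to a regular surface hug -/
  regular : (∃ i, IsRegularLocalRing (C.R i)) → RegularSurfaceHugging T

attribute [instance] HugShadow.instField

/-! ## §3 Tower classes and the three pieces
[WRITER NOTE (decomp-res writer g5, review of p777528): `SingularClass` is the tree's `NearPointCut.SingularClass`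
(Theorems/NearPointCutClasses — the JOINT residual class with lens-4 g13) and `NoTowerImperfect` is the tree's
`ContactShadowClasses.NoTowerImperfect` (kernels `ContactShadowKernels.noTowerImperfect_of_noTower` / `noTowerImperfect_mono` /
`noTower_iff_columns`); both are opened BY NAME, not restated.] -/

/-- DISCRETE SHADOW: some hug shadow of `T` is dominated by a `ℤ`-valued valuation ring of its function field (the
marked points are the centres of a DISCRETE rank-one valuation of the hugged surface — an «arc»). -/
def DiscreteShadow (T : ForcedTower) : Prop :=
  ∃ S : HugShadow T, ∃ V : ValuationSubring S.K, S.C.DominatedBy V ∧ IsZValued V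

/-- DENSE SHADOW: `T` has hug shadows and NONE of them is dominated by a `ℤ`-valued valuation ring (every
dominating valuation ring of every shadow — they exist, `HugChain.exists_dominatedBy` — has a non-discrete value
group; rank one by (R) of the docstring).  `DiscreteShadow` / `DenseShadow` PARTITION the towers with a shadow. -/
def DenseShadow (T : ForcedTower) : Prop :=
  Nonempty (HugShadow T) ∧ ¬ DiscreteShadow T

/-- **PIECE (D) — the DISCRETE column, all ground fields**: singular-class towers with a discrete shadow. -/
def DiscreteShadowTowersTerminate (n : ℕ) : Prop :=
  NoTower n fun T => SingularClass T ∧ DiscreteShadow T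

/-- **PIECE (D-perf) · DECIDED-MOD-PORT (engine `DiscreteShadowLaw`, paper proof (P3)): the discrete column over
PERFECT ground fields.** -/
def DiscretePerfectShadowTowersTerminate (n : ℕ) : Prop :=
  NoTowerPerfect n fun T => SingularClass T ∧ DiscreteShadow T

/-- **PIECE (D-imp) · UNDECIDED residual: the discrete column over IMPERFECT ground fields** (regular-but-not-smooth
ambient; no Jacobian criterion; see (P3′)). -/
def DiscreteImperfectShadowTowersTerminate (n : ℕ) : Prop :=
  NoTowerImperfect n fun T => SingularClass T ∧ DiscreteShadow T

/-- **PIECE (Z) = THE LOCATED RESIDUAL · UNDECIDED · normal form «rank-one non-discrete valuation with creeping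
values»**: singular-class towers with a dense shadow. -/
def DenseShadowTowersTerminate (n : ℕ) : Prop :=
  NoTower n fun T => SingularClass T ∧ DenseShadow T

/-! ## §4 Ports (HYPOTHESES of kernels, counted 0; paper proofs in the module docstring) -/

/-- **PORT `ShadowPort` — COSTUME** (paper proof (P1): an eternal component of the hugged germ is an integral
SURFACE because no curve is hugged; its strict transforms are its point blow-ups; their local rings at the marked points,
read in its function field, form a hug chain — tree `IsQuadraticTransform`, cf. the tree's
`IsBlowup.isQuadraticTransformAlong_range_stalkEmb`; the two dictionary clauses).  Every tower of the class hugging a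
surface but no curve admits a hug shadow. -/
def ShadowPort (n : ℕ) : Prop :=
  ∀ p : ℕ, p.Prime → ∀ (k : Type) [Field k] [CharP k p] (T : ForcedTower) (g : T.St 0 ⟶ Spec (.of k)),
    IsBase (T.St 0) g → IsDatum n (T.D 0) → (T.D 0).boundary = [] → ¬ CurveHugging T → SurfaceHugging T →
      Nonempty (HugShadow T)

/-- **PORT `DiscreteShadowLaw` — the ENGINE of the discrete column over PERFECT fields** (NEW LEMMA in this
generality, complete paper proof (P3) in the module docstring; printed antecedents in characteristic zero: the
arc-lifting / Nash-multiplicity lemma [Nash 1995 Duke 81; Lejeune-Jalabert 1990 AJM 112; Gonzalez-Sprinberg &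
Lejeune-Jalabert 1996 Thm 4-1]): along a discrete shadow of a tower over a perfect field, SOME member of the shadow
chain is a regular local ring (indeed all but at most `c₀` of them, `c₀` = the order of contact of the arc with the
Jacobian ideal of a generic complete-intersection hull of the germ). -/
def DiscreteShadowLaw (n : ℕ) : Prop :=
  ∀ p : ℕ, p.Prime → ∀ (k : Type) [Field k] [CharP k p] [PerfectField k] (T : ForcedTower)
    (g : T.St 0 ⟶ Spec (.of k)),
    IsBase (T.St 0) g → IsDatum n (T.D 0) → (T.D 0).boundary = [] →
      ∀ (S : HugShadow T) (V : ValuationSubring S.K), S.C.DominatedBy V → IsZValued V →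
        ∃ i, IsRegularLocalRing (S.C.R i)

/-! ## §6 Up to the booked MaxContactCut items BY NAME -/

/-- The g14 residual (Z) over all markings: «no singular-class tower with a dense shadow». -/
def NoDenseShadowTowers : Prop := ∀ n : ℕ, 1 ≤ n → DenseShadowTowersTerminate n

/-- The g14 residual (D-imp) over all markings: «no singular-class tower with a discrete shadow over an imperfect
field». -/
def NoDiscreteImperfectShadowTowers : Prop := ∀ n : ℕ, 1 ≤ n → DiscreteImperfectShadowTowersTerminate n

/-- The port over all markings. -/
def ShadowPortAll : Prop := ∀ n : ℕ, 1 ≤ n → ShadowPort n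

/-- The engine over all markings. -/
def DiscreteShadowLawAll : Prop := ∀ n : ℕ, 1 ≤ n → DiscreteShadowLaw n


end Summit.ResolutionOfSingularities.ResolutionOfSingularities.Theorems.HugValuationCut

end
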